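import Summits.QuantumFields.YangMills.Theorems.BalabanUVNodesN20CutDialFoldSlot
import Summits.QuantumFields.YangMills.Theorems.BalabanUVNodesK3V6Defs

/-!
# BalabanUVNodes ∕ N20 (NE7b) — THE CUT DIAL OF K3⁸'s REGISTERED STUB 2 IS ELIMINABLE, AT THE v6 TEXTS BY NAME (dag-n27-w1's mirror `Thm/BalabanUVNodesK3V6Defs`, p625739):
# `stub_expansion13HV`'s TEXT «∀ β 𝔯 ksel ℓ ℓ₃ g B, GuardedReadingN16 … → KeyedRatesHolderD4V β (rrOfRecord 𝔯 ksel) → ∃ jc sh cr, PinnedAtLive jc sh cr ∧ KeyedRelWeight cr ∧ KeyedShellWeight cr ∧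
# KeyedExtractionV cr ∧ KeyedCoreEdgeHolderD4V β cr (rrOfRecord 𝔯 ksel)» ⟺ THE SAME TEXT WITH THE ZERO CUT READING `jc := fun _ _ _ _ _ _ ↦ 0`; the same for the (B)-FREE texts; K3⁸
# (and the aside K3⁷ display) from stub 1's text + the zero-cut text of stub 2

Cell `pub-ymgap` (HUMAN RULING D-0062 Track A; width push D-0149, director-ym №197), width seat `pub-ymgap-dag-n20-w2` (gen 6) on node N20 = NE7b; key item K3⁸
`SpineGivenEndpointR13SepCoPHV` = stmt-QuantumFields-27366 (dag-lead KEY MAP v2; K3⁷ stmt-QuantumFields-20544 aside); `--kind proof --supports stmt-QuantumFields-27366 --as helper`;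
COUNT-NEUTRAL; LOCATED.  Bus: CLAIM-1 ∕ INTENT-1 (pub-ymgap INBOX l.38627; first refusal to dag-n20-w1).  THEOREMS ONLY; imports this seat's cone-free `…N20CutDialFoldSlot` (§1 the
fold package `exists_foldedPair`, §2 the v6-shaped `stubTwoBodyV_iff_zeroCut`) and dag-n27-w1's v6 mirror `…K3V6Defs` (p625739; namespace `Summit.QuantumFields.YangMills.Theorems.K3V6Defs`:
`KeyedExtractionV ∕ KeyedCoreEdgeHolderD4V ∕ KeyedExtractionBFree ∕ KeyedCoreEdgeHolderD4BFree`, the compositions `spineGivenEndpointR13SepCoPHV_of_stubTextsV ∕ _of_stubTextsBFree`,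
`spineGivenEndpointR13SepCoPH_of_stubTextsBFree`; over its v5 mirror `K3V5Defs` p606160: `CutReading`, `SpineReading`, `RateReadingFn`, `RunSel`, `LetterReading`, `rrOfRecord`, `PHolderD4`,
`GuardedReadingN16`, `KeyedRelWeight`, `KeyedShellWeight`, `LiveSel`, `PinnedAtLive`, `KeyedRatesHolderD4V ∕ BFree`) — all BY NAME (`δ`-unfolding only, no re-typing); modifies nothing.
Like dag-n20-w1's v5 edition `…N20CutDialStubText` (p614769) and dag-n20-w3's 13R ∕ 13T this file sits INSIDE the route's import cone (`K3V5Defs` imports the Theses file by design).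
[III] = [Balaban1988Convergent], [LF-II] = [Balaban1989LargeFieldII], [I] = [Balaban1987RG1], [King1986] = CMP 102.

WHY.  K3⁸'s skeleton v6 (b4e55110ab73e679) kept v5's `∃ (jc : CutReading)` in `stub_expansion13HV` and re-keyed the N27x ∕ N19′ conjuncts at DEF-1's version slot.  dag-n20-w1's v5
elimination (`stubTwoBody_iff_zeroCut` p606432, by-name `stub2Text_iff_zeroCutText` p614769) therefore does not apply to the registered text; `…N20CutDialFoldSlot` re-ran it at the v6
shapes.  THIS FILE instantiates AT THE MIRROR's NAMES (`N := 2`, `G := ZhUnity ∧ SlotsNondegenerate₁₃`, `Live := LiveSel`, `PremV := PHolderD4 β (datumOfRecord₁₃SepCoPHV F 2 θ h v)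
(rr F θ h.toCore g₀ os)`), lifts through the stub's prefix, does the same for the (B)-FREE texts (whose N27x ∕ N19′ faces carry NO (B) ∕ END antecedent — an instance of NEITHER spelled
lemma; proved directly from the fold package), and records the compositions of THE ITEM from stub 1's text and the ZERO-CUT text of stub 2:
* §1 ★★ `stub2BodyV_iff_zeroCutBodyV` (fixed `β`, `rr`) · ★★★ `stub2TextV_iff_zeroCutTextV` (`stub_expansion13HV`'s REGISTERED TEXT, verbatim = the `h₂` binder of
  `K3V6Defs.spineGivenEndpointR13SepCoPHV_of_stubTextsV`, ⟺ its zero-cut edition) · ★ `spineGivenEndpointR13SepCoPHV_of_stub1TextV_of_zeroCutTextV`.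
* §2 ★★ `stub2BodyBFree_iff_zeroCutBodyBFree` · ★★ `stub2TextBFree_iff_zeroCutTextBFree` (the `h₂` binder of `…_of_stubTextsBFree`) · `spineGivenEndpointR13SepCoPHV_of_stub1TextBFree_of_zeroCutTextBFree`
  · `spineGivenEndpointR13SepCoPH_of_stub1TextBFree_of_zeroCutTextBFree` (the aside K3⁷ display from the same pair).
LOCATED (for plan g86 ∕ dag-lead ∕ the K3⁸ lanes; said, not decided): whichever pin a v7 names (identity — v6's; gapped — dag-n21-d's V1–V5; a key-reading dial — dag-n20-d's 13K), the
cut dial `∃ jc` of the registered text is the prover's and ELIMINABLE BUDGET-FREE, and at `jc ≡ 0` the N20 conjunct `KeyedRelWeight cr` books nothing on the live line (this lineage's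
g0 p590852 ∕ g5 p633479 for ANY carriers; dag-n20-w1's `keyedRelWeight_shape_crOfRecord₁₃V_cutZero`): stub 2's two-run content at the record is N21 `KeyedShellWeight`, N27x and the
N19′ core edge on EVERY keyed class — exactly as at v5 (dag-n20-w3's 13R located the shell dial likewise).  A v7 MAY drop `∃ jc` with `stub2TextV_iff_zeroCutTextV` as the v6→v7 adapter.

HONEST FRAMING.  [bookkeeping] — instances of landed theorems and by-name compositions; an EQUIVALENCE OF HYPOTHESIS SHAPES and CONDITIONAL compositions; neither stub text is inhabited
here, no witness is built from Bałaban's objects (K3⁸ stubs 1 and 2 OPEN; K0⁷ `Record13SepCoPHInhabited` OPEN); proves NO estimate; nothing of Bałaban's asserted.  NE7 ∕ NE7b ∕ NE7c NOT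
PRINTED for `d = 4`, NOT proved; (α)-instance 0∕1; N19 ∕ N20 ∕ N21 ∕ N27 NOT discharged; K3⁸ NOT closed, NOT claimed; skeleton v6 UNTOUCHED (the zero-cut text is NOT registered — a
located v7 input, decided by the plan); K3⁷ aside; counts unmoved (typed 28∕28 · discharged 5∕27); no count claim (the chair's single count line is the only count).  One finite
`𝕋⁴_{L^K}` programme at fixed `ε = L^{−K}`, Bałaban AS PRINTED; the YM mass gap (Clay) is NOT proved by any of this — R4 closes the conditional finite-𝕋⁴ rung `BalabanLadder.UV` only;
NOT ℝ⁴, NOT continuum, NOT OS.  Gate note: the `lint.theses-cone` warning is inherited from importing the by-name mirror `K3V6Defs` (→ `K3V5Defs` → the route file), exactly as for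
p614769 ∕ 13R ∕ 13T.  No `def`, no `instance`, no `notation`, no `sorry`.  Sources (location only): [III] (2.18) p.257, (3.23) p.270; [LF-II] (1.80) p.384; [I] Thm 2 p.259;
[King1986] (3.10)–(3.13) pp.656–657.
-/

set_option autoImplicit false

noncomputable section

namespace Summit.QuantumFields.YangMills.BalabanUVNodes.N20CutDialStubTextK3V6

open Literature.MathematicalPhysics.QuantumFieldTheory.Balaban1983to89
open Literature.MathematicalPhysics.QuantumFieldTheory.Balaban1983to89.T4Continuum
open Literature.MathematicalPhysics.QuantumFieldTheory.Balaban1983to89.Node00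
open T4ContinuumYM4Torus (ForSmallCouplings)
open YMDAG.UVSplit hiding SU
open Summit.QuantumFields.YangMills.Theorems.K3V5Defs
open Summit.QuantumFields.YangMills.Theorems.K3V6Defs
open Summit.QuantumFields.YangMills.BalabanUVNodes.N20CutDialFoldSlot (exists_foldedPair stubTwoBodyV_iff_zeroCut)

/-! ## §1  `stub_expansion13HV`'s registered text ⟺ its zero-cut edition -/

/-- ★★ **THE v6 STUB-2 BODY ⟺ ITS ZERO-CUT BODY, IN THE MIRROR's NAMES** [bookkeeping]: for a fixed Hölder exponent `β` and rate reading `rr`, K3⁸ v6 `stub_expansion13HV`'s conclusion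
«`∃ jc sh cr, PinnedAtLive jc sh cr ∧ KeyedRelWeight cr ∧ KeyedShellWeight cr ∧ KeyedExtractionV cr ∧ KeyedCoreEdgeHolderD4V β cr rr`» holds iff it holds WITH THE ZERO CUT READING —
`…N20CutDialFoldSlot.stubTwoBodyV_iff_zeroCut` at `N := 2`, `Live := LiveSel`, `G := ZhUnity ∧ SlotsNondegenerate₁₃`, `PremV := PHolderD4 β (datumOfRecord₁₃SepCoPHV F 2 θ h v) (rr F θ h.toCore g₀ os)`
(pure `δ`-unfolding of the mirrors' `def`s). [cite: King1986, (3.10)–(3.13) pp.656–657; Balaban1989LargeFieldII, (1.80) p.384 (bookkeeping)] -/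
theorem stub2BodyV_iff_zeroCutBodyV (β : ℝ) (rr : RateReadingFn) :
    (∃ (jc : CutReading) (sh : ShellSplit₁₃CoPH 2 0) (cr : SpineReading),
        PinnedAtLive jc sh cr ∧ KeyedRelWeight cr ∧ KeyedShellWeight cr ∧ KeyedExtractionV cr ∧ KeyedCoreEdgeHolderD4V β cr rr) ↔
    (∃ (sh : ShellSplit₁₃CoPH 2 0) (cr : SpineReading),
        PinnedAtLive (fun _ _ _ _ _ _ => 0) sh cr ∧ KeyedRelWeight cr ∧ KeyedShellWeight cr ∧ KeyedExtractionV cr ∧ KeyedCoreEdgeHolderD4V β cr rr) :=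
  stubTwoBodyV_iff_zeroCut LiveSel (fun F θ => θ.ZhUnity F 2 ∧ θ.SlotsNondegenerate₁₃ F 2)
    (fun F θ h v g₀ os => PHolderD4 β (datumOfRecord₁₃SepCoPHV F 2 θ h v) (rr F θ h.toCore g₀ os))

/-- ★★★ **`stub_expansion13HV`'s REGISTERED TEXT ⟺ ITS ZERO-CUT EDITION** [bookkeeping] (K3⁸ skeleton v6 b4e55110ab73e679; the text in dag-n27-w1's mirror names, verbatim = the `h₂`
binder of `K3V6Defs.spineGivenEndpointR13SepCoPHV_of_stubTextsV`).  The zero-cut edition replaces `∃ (jc : CutReading)` by the zero cut reading and keeps every other letter. -/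
theorem stub2TextV_iff_zeroCutTextV :
    (∀ β : ℝ, 2 / 3 < β → β < 1 → ∀ (𝔯 : RateReading₁₃CoPH 2) (ksel : RunSel) (ℓ : LetterReading) (ℓ₃ : T4Family → Node00.NE3Letters₁₁) (g B : T4Family → ℝ),
      GuardedReadingN16 𝔯 ksel ℓ ℓ₃ g B → KeyedRatesHolderD4V β (rrOfRecord 𝔯 ksel) →
      ∃ (jc : CutReading) (sh : ShellSplit₁₃CoPH 2 0) (cr : SpineReading), PinnedAtLive jc sh cr ∧
        KeyedRelWeight cr ∧ KeyedShellWeight cr ∧ KeyedExtractionV cr ∧ KeyedCoreEdgeHolderD4V β cr (rrOfRecord 𝔯 ksel)) ↔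
    (∀ β : ℝ, 2 / 3 < β → β < 1 → ∀ (𝔯 : RateReading₁₃CoPH 2) (ksel : RunSel) (ℓ : LetterReading) (ℓ₃ : T4Family → Node00.NE3Letters₁₁) (g B : T4Family → ℝ),
      GuardedReadingN16 𝔯 ksel ℓ ℓ₃ g B → KeyedRatesHolderD4V β (rrOfRecord 𝔯 ksel) →
      ∃ (sh : ShellSplit₁₃CoPH 2 0) (cr : SpineReading), PinnedAtLive (fun _ _ _ _ _ _ => 0) sh cr ∧
        KeyedRelWeight cr ∧ KeyedShellWeight cr ∧ KeyedExtractionV cr ∧ KeyedCoreEdgeHolderD4V β cr (rrOfRecord 𝔯 ksel)) :=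
  forall₃_congr fun β _ _ => forall₅_congr fun 𝔯 ksel _ _ _ => forall_congr' fun _ => forall₂_congr fun _ _ =>
    stub2BodyV_iff_zeroCutBodyV β (rrOfRecord 𝔯 ksel)

/-- ★ **K3⁸ FROM STUB 1's TEXT AND THE ZERO-CUT TEXT OF STUB 2** [bookkeeping]: dag-n27-w1's by-name composition `K3V6Defs.spineGivenEndpointR13SepCoPHV_of_stubTextsV` after
`stub2TextV_iff_zeroCutTextV`.  Both texts are HYPOTHESES; no stub is proved; the skeleton of record is untouched. -/
theorem spineGivenEndpointR13SepCoPHV_of_stub1TextV_of_zeroCutTextV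
    (h₁ : ∃ β : ℝ, 2 / 3 < β ∧ β < 1 ∧ ∃ (𝔯 : RateReading₁₃CoPH 2) (ksel : RunSel) (ℓ : LetterReading) (ℓ₃ : T4Family → Node00.NE3Letters₁₁) (g B : T4Family → ℝ),
      GuardedReadingN16 𝔯 ksel ℓ ℓ₃ g B ∧ KeyedRatesHolderD4V β (rrOfRecord 𝔯 ksel))
    (h₂z : ∀ β : ℝ, 2 / 3 < β → β < 1 → ∀ (𝔯 : RateReading₁₃CoPH 2) (ksel : RunSel) (ℓ : LetterReading) (ℓ₃ : T4Family → Node00.NE3Letters₁₁) (g B : T4Family → ℝ),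
      GuardedReadingN16 𝔯 ksel ℓ ℓ₃ g B → KeyedRatesHolderD4V β (rrOfRecord 𝔯 ksel) →
      ∃ (sh : ShellSplit₁₃CoPH 2 0) (cr : SpineReading), PinnedAtLive (fun _ _ _ _ _ _ => 0) sh cr ∧
        KeyedRelWeight cr ∧ KeyedShellWeight cr ∧ KeyedExtractionV cr ∧ KeyedCoreEdgeHolderD4V β cr (rrOfRecord 𝔯 ksel)) :
    Summit.QuantumFields.YangMills.Theses.BalabanUVNodes.SpineGivenEndpointR13SepCoPHV :=
  spineGivenEndpointR13SepCoPHV_of_stubTextsV h₁ (stub2TextV_iff_zeroCutTextV.2 h₂z)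

/-! ## §2  The (B)-free texts: the same elimination (the faces carry no (B) ∕ END antecedent; proved from the fold package) -/

/-- ★★ **THE (B)-FREE STUB-2 BODY ⟺ ITS ZERO-CUT BODY** [bookkeeping]: for fixed `β`, `rr`, «`∃ jc sh cr, PinnedAtLive jc sh cr ∧ KeyedRelWeight cr ∧ KeyedShellWeight cr ∧
KeyedExtractionBFree cr ∧ KeyedCoreEdgeHolderD4BFree β cr rr`» ⟺ the same with the zero cut reading — the fold package `exists_foldedPair` at `Live := LiveSel` pushed through the
(B)-free prefix `ForSmallCouplings (datumOfRecord₁₃CoPH F 2 θ hP)` (the extraction letter `Z` = the record datum's Wilson schemes). [cite: King1986, (3.10)–(3.13) pp.656–657 (bookkeeping)] -/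
theorem stub2BodyBFree_iff_zeroCutBodyBFree (β : ℝ) (rr : RateReadingFn) :
    (∃ (jc : CutReading) (sh : ShellSplit₁₃CoPH 2 0) (cr : SpineReading),
        PinnedAtLive jc sh cr ∧ KeyedRelWeight cr ∧ KeyedShellWeight cr ∧ KeyedExtractionBFree cr ∧ KeyedCoreEdgeHolderD4BFree β cr rr) ↔
    (∃ (sh : ShellSplit₁₃CoPH 2 0) (cr : SpineReading),
        PinnedAtLive (fun _ _ _ _ _ _ => 0) sh cr ∧ KeyedRelWeight cr ∧ KeyedShellWeight cr ∧ KeyedExtractionBFree cr ∧ KeyedCoreEdgeHolderD4BFree β cr rr) := by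
  refine ⟨fun ⟨jc, sh, cr, hpin, h20, h21, hx, h19⟩ => ?_, fun ⟨sh, cr, h⟩ => ⟨fun _ _ _ _ _ _ => 0, sh, cr, h⟩⟩
  obtain ⟨shS, crS, hon, -, -, hc', hd, he, hf⟩ := exists_foldedPair LiveSel jc sh cr hpin
  refine ⟨shS, crS, hon, fun F θ hP hG hθ g₀ os => hc' F θ hP g₀ os (h20 F θ hP hG hθ g₀ os),
    fun F θ hP hG hθ g₀ os => hd F θ hP g₀ os (h20 F θ hP hG hθ g₀ os) (h21 F θ hP hG hθ g₀ os), ?_, ?_⟩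
  · -- N27x, (B)-free: the extraction body with the RECORD datum's Wilson schemes as the letter `Z`
    intro F θ hP hG hθ
    exact ForSmallCouplings.mono
      (fun g₀ hg os => (he F θ hP g₀ os (fun k t => T4GenFunBounds.schemeZ ((datumOfRecord₁₃CoPH F 2 θ hP).scheme g₀) os k t)).1 (hg os)) (hx F θ hP hG hθ)
  · -- N19′, (B)-free: the same `δ` after the fold, under the (B)-free prefix and premise
    intro F θ hP hG hθ
    exact ForSmallCouplings.mono (fun g₀ hg os hprem => hf F θ hP g₀ os (hg os hprem)) (h19 F θ hP hG hθ)

/-- ★★ **THE (B)-FREE STUB-2 TEXT ⟺ ITS ZERO-CUT EDITION** [bookkeeping] (verbatim = the `h₂` binder of `K3V6Defs.spineGivenEndpointR13SepCoPHV_of_stubTextsBFree`). -/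
theorem stub2TextBFree_iff_zeroCutTextBFree :
    (∀ β : ℝ, 2 / 3 < β → β < 1 → ∀ (𝔯 : RateReading₁₃CoPH 2) (ksel : RunSel) (ℓ : LetterReading) (ℓ₃ : T4Family → Node00.NE3Letters₁₁) (g B : T4Family → ℝ),
      GuardedReadingN16 𝔯 ksel ℓ ℓ₃ g B → KeyedRatesHolderD4BFree β (rrOfRecord 𝔯 ksel) →
      ∃ (jc : CutReading) (sh : ShellSplit₁₃CoPH 2 0) (cr : SpineReading), PinnedAtLive jc sh cr ∧
        KeyedRelWeight cr ∧ KeyedShellWeight cr ∧ KeyedExtractionBFree cr ∧ KeyedCoreEdgeHolderD4BFree β cr (rrOfRecord 𝔯 ksel)) ↔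
    (∀ β : ℝ, 2 / 3 < β → β < 1 → ∀ (𝔯 : RateReading₁₃CoPH 2) (ksel : RunSel) (ℓ : LetterReading) (ℓ₃ : T4Family → Node00.NE3Letters₁₁) (g B : T4Family → ℝ),
      GuardedReadingN16 𝔯 ksel ℓ ℓ₃ g B → KeyedRatesHolderD4BFree β (rrOfRecord 𝔯 ksel) →
      ∃ (sh : ShellSplit₁₃CoPH 2 0) (cr : SpineReading), PinnedAtLive (fun _ _ _ _ _ _ => 0) sh cr ∧
        KeyedRelWeight cr ∧ KeyedShellWeight cr ∧ KeyedExtractionBFree cr ∧ KeyedCoreEdgeHolderD4BFree β cr (rrOfRecord 𝔯 ksel)) :=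
  forall₃_congr fun β _ _ => forall₅_congr fun 𝔯 ksel _ _ _ => forall_congr' fun _ => forall₂_congr fun _ _ =>
    stub2BodyBFree_iff_zeroCutBodyBFree β (rrOfRecord 𝔯 ksel)

/-- **K3⁸ FROM THE (B)-FREE STUB-1 TEXT AND THE ZERO-CUT (B)-FREE TEXT OF STUB 2** [bookkeeping]: dag-n27-w1's `K3V6Defs.spineGivenEndpointR13SepCoPHV_of_stubTextsBFree` after
`stub2TextBFree_iff_zeroCutTextBFree` — K3⁸ at EVERY version slot from the one (B)-free road.  Both texts HYPOTHESES; no stub is proved. -/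
theorem spineGivenEndpointR13SepCoPHV_of_stub1TextBFree_of_zeroCutTextBFree
    (h₁ : ∃ β : ℝ, 2 / 3 < β ∧ β < 1 ∧ ∃ (𝔯 : RateReading₁₃CoPH 2) (ksel : RunSel) (ℓ : LetterReading) (ℓ₃ : T4Family → Node00.NE3Letters₁₁) (g B : T4Family → ℝ),
      GuardedReadingN16 𝔯 ksel ℓ ℓ₃ g B ∧ KeyedRatesHolderD4BFree β (rrOfRecord 𝔯 ksel))
    (h₂z : ∀ β : ℝ, 2 / 3 < β → β < 1 → ∀ (𝔯 : RateReading₁₃CoPH 2) (ksel : RunSel) (ℓ : LetterReading) (ℓ₃ : T4Family → Node00.NE3Letters₁₁) (g B : T4Family → ℝ),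
      GuardedReadingN16 𝔯 ksel ℓ ℓ₃ g B → KeyedRatesHolderD4BFree β (rrOfRecord 𝔯 ksel) →
      ∃ (sh : ShellSplit₁₃CoPH 2 0) (cr : SpineReading), PinnedAtLive (fun _ _ _ _ _ _ => 0) sh cr ∧
        KeyedRelWeight cr ∧ KeyedShellWeight cr ∧ KeyedExtractionBFree cr ∧ KeyedCoreEdgeHolderD4BFree β cr (rrOfRecord 𝔯 ksel)) :
    Summit.QuantumFields.YangMills.Theses.BalabanUVNodes.SpineGivenEndpointR13SepCoPHV :=
  spineGivenEndpointR13SepCoPHV_of_stubTextsBFree h₁ (stub2TextBFree_iff_zeroCutTextBFree.2 h₂z)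

/-- … and the same pair gives the ASIDE K3⁷ display `SpineGivenEndpointR13SepCoPH` (stmt-QuantumFields-20544) through dag-n27-w1's
`K3V6Defs.spineGivenEndpointR13SepCoPH_of_stubTextsBFree` — both displays from ONE (B)-free road with the zero cut. [bookkeeping] -/
theorem spineGivenEndpointR13SepCoPH_of_stub1TextBFree_of_zeroCutTextBFree
    (h₁ : ∃ β : ℝ, 2 / 3 < β ∧ β < 1 ∧ ∃ (𝔯 : RateReading₁₃CoPH 2) (ksel : RunSel) (ℓ : LetterReading) (ℓ₃ : T4Family → Node00.NE3Letters₁₁) (g B : T4Family → ℝ),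
      GuardedReadingN16 𝔯 ksel ℓ ℓ₃ g B ∧ KeyedRatesHolderD4BFree β (rrOfRecord 𝔯 ksel))
    (h₂z : ∀ β : ℝ, 2 / 3 < β → β < 1 → ∀ (𝔯 : RateReading₁₃CoPH 2) (ksel : RunSel) (ℓ : LetterReading) (ℓ₃ : T4Family → Node00.NE3Letters₁₁) (g B : T4Family → ℝ),
      GuardedReadingN16 𝔯 ksel ℓ ℓ₃ g B → KeyedRatesHolderD4BFree β (rrOfRecord 𝔯 ksel) →
      ∃ (sh : ShellSplit₁₃CoPH 2 0) (cr : SpineReading), PinnedAtLive (fun _ _ _ _ _ _ => 0) sh cr ∧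
        KeyedRelWeight cr ∧ KeyedShellWeight cr ∧ KeyedExtractionBFree cr ∧ KeyedCoreEdgeHolderD4BFree β cr (rrOfRecord 𝔯 ksel)) :
    Summit.QuantumFields.YangMills.Theses.BalabanUVNodes.SpineGivenEndpointR13SepCoPH :=
  spineGivenEndpointR13SepCoPH_of_stubTextsBFree h₁ (stub2TextBFree_iff_zeroCutTextBFree.2 h₂z)

end Summit.QuantumFields.YangMills.BalabanUVNodes.N20CutDialStubTextK3V6

end
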